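import Mathlib
import HarnessLib
import Summits.CriticalPhenomena.CardyFormulaZ2.Theses.CardyMagicRigidity
import Literature.Probability.Percolation.FullPlaneCNL
import Literature.Probability.RandomPlanarGeometry.NestingTransform

/-!
# Sketch — first lemmas of the crux-idea cards for `CardyMagicRigidity.MagicFormulaT`
(planner-cruxidea-stmt-CriticalPhenomena-4836-2-0, round 1). Statements only (Props); nothing is proved here.
-/

noncomputable section

namespace Summit.CriticalPhenomena.CardyFormulaZ2.Cruxes.MagicFormulaT.Sketch

open MeasureTheory Filter
open scoped Topology
open Literature.Probability.RandomPlanarGeometry Literature.Probability.Percolation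
  Literature.Probability.LatticeModels

/-- Admissible test densities of the crux (bounded, compactly supported, measurable, mass zero). -/
def Admissible (f : ℂ → ℝ) : Prop :=
  Measurable f ∧ (∃ C : ℝ, ∀ z, |f z| ≤ C) ∧ (∃ R : ℝ, ∀ z, R < ‖z‖ → f z = 0) ∧ ∫ z, f z = 0

/-- The Gaussian (magic) value `exp((3/4π²) ∬ log‖x−y‖ f(x) f(y))`. -/
def gaussValue (f : ℂ → ℝ) : ℝ :=
  Real.exp (3 / (4 * Real.pi ^ 2) * ∫ x, ∫ y, Real.log ‖x - y‖ * f x * f y)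

/-- **Card coulomb-gas-exploration-martingale, first lemma (continuum magic formula for CLE₆).**
For every full-plane CNL (= Camia–Newman CLE₆) law `(μ, X)` and every admissible `f`, the
`ε`-truncated twisted nesting transforms converge, as `ε → 0⁺`, to the Gaussian value. -/
def ContinuumMagicCLE6 : Prop :=
  ∀ (Ω : Type) [MeasurableSpace Ω] (μ : Measure Ω) (X : Ω → LoopConfig ℂ),
    IsProbabilityMeasure μ → IsFullPlaneCNLLaw μ X →
      ∀ f : ℂ → ℝ, Admissible f → HasNestingTransform μ X f (gaussValue f)

/-- **Continuity on 𝕋 ("restrict to big loops", 𝕋 side only).** If the continuum transform of the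
CLE₆ law exists at `f` with value `Λ`, the lattice transform of site-𝕋 percolation tends to `Λ`
(RSW on 𝕋 + Camia–Newman; no ℤ² input). -/
def BigLoopContinuityT : Prop :=
  ∀ (Ω : Type) [MeasurableSpace Ω] (μ : Measure Ω) (X : Ω → LoopConfig ℂ),
    IsProbabilityMeasure μ → IsFullPlaneCNLLaw μ X →
      ∀ f : ℂ → ℝ, Admissible f → ∀ Λ : ℝ, HasNestingTransform μ X f Λ →
        Tendsto (fun δ : ℝ ↦ ∫ cfg, (siteLoopConfig δ cfg).nestingWeight f ∂(triSitePercolation half))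
          (𝓝[>] 0) (𝓝 Λ)

/-- The line closes the crux from the two lemmas (statement of the composition; the proof is the
definitional identity `siteLoopConfig_eq` + `nestingWeight_eq_finprod`, for the crux-plan stage). -/
def LineCloses : Prop :=
  ContinuumMagicCLE6 → BigLoopContinuityT →
    Summit.CriticalPhenomena.CardyFormulaZ2.Theses.CardyMagicRigidity.MagicFormulaT

/-- **Card cumulant-hierarchy, transfer C⁺ (Gaussianity is all that is needed).** If the transform
of the CLE₆ law is log-quadratic on every two-parameter family of admissible densities, then it IS
the magic Gaussian (the constant `3/4π²` is forced by covariance + the SSW two-point exponent). -/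
def QuadraticOnPlanes {Ω : Type} [MeasurableSpace Ω] (μ : Measure Ω) (X : Ω → LoopConfig ℂ) : Prop :=
  ∀ f g : ℂ → ℝ, Admissible f → Admissible g → ∃ a b c : ℝ, ∀ s t : ℝ,
    HasNestingTransform μ X (fun z ↦ s * f z + t * g z) (Real.exp (a * s ^ 2 + b * s * t + c * t ^ 2))

def GaussianityOnlyTransfer : Prop :=
  ∀ (Ω : Type) [MeasurableSpace Ω] (μ : Measure Ω) (X : Ω → LoopConfig ℂ),
    IsProbabilityMeasure μ → IsFullPlaneCNLLaw μ X → QuadraticOnPlanes μ X →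
      ∀ f : ℂ → ℝ, Admissible f → HasNestingTransform μ X f (gaussValue f)

/-- **Card cumulant-hierarchy, first lemma (order 3 = imaginary-DOZZ degeneration at κ = 6).**
The third Taylor coefficient at `t = 0` of `t ↦ log Λ_{CLE₆}(t f)` vanishes:
`log Λ(tf) − q t² = o(t³)` for some `q`. (Order 2 is free; this is the first contentful order.) -/
def ThirdCumulantVanishes : Prop :=
  ∀ (Ω : Type) [MeasurableSpace Ω] (μ : Measure Ω) (X : Ω → LoopConfig ℂ),
    IsProbabilityMeasure μ → IsFullPlaneCNLLaw μ X →
      ∀ f : ℂ → ℝ, Admissible f → (∀ t : ℝ, ∃ Λ, HasNestingTransform μ X (fun z ↦ t * f z) Λ) →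
        ∃ q : ℝ, (fun t : ℝ ↦ Real.log (nestingTransform μ X (fun z ↦ t * f z)) - q * t ^ 2)
          =o[𝓝 0] fun t : ℝ ↦ t ^ 3

/-! ### Card identity-charge-decoupling: the conjugate-identity defect -/

/-- Loop weight with a CONJUGATION DEFECT at `c`: loops surrounding `c` (non-zero winding number about `c`)
get `2cos(−a + π/3) = 2cos(a − 2π/3 + π/3)`, i.e. the point charge `λ* = −2π/3` sits at `c`; other loops keep
`2cos(a + π/3)`. No renormalisation is needed since `2cos(λ* + π/3) = 1`. -/
def defectFactor (f : ℂ → ℝ) (c : ℂ) (u : UnbasedLoop ℂ) : ℝ :=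
  2 * Real.cos ((if u.wind c ≠ 0 then (-1 : ℝ) else 1) * u.nestingPhase f + Real.pi / 3)

/-- `ε`-truncated defect transform `E_P[∏_{diam u ≥ ε} defectFactor f c u]`. -/
def truncDefectTransform {Ω : Type} [MeasurableSpace Ω] (P : Measure Ω) (X : Ω → LoopConfig ℂ)
    (f : ℂ → ℝ) (c : ℂ) (ε : ℝ) : ℝ :=
  ∫ ω, (∏ᶠ u ∈ (X ω).bigLoops ε, defectFactor f c u) ∂P

/-- **DEFECT COVARIANCE (the conjugate identity is a pure vertex operator):** for the CLE₆ law, adding the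
conjugate-identity charge `λ* = −2π/3` at `c` (equivalently: conjugating every loop around `c`, i.e. moving
the base point from `∞` to `c`) multiplies the transform by the free-field cross term and NOTHING else:
`Λ(f; defect at c) = Λ(f) · exp(−(1/π) ∫ log‖x − c‖ f(x) dx)`. First order in `f` is loop counting
(`2√3·ν = 1/π`, `ν = 1/(2π√3)` the CLE₆ nesting density); the content is that all higher connected orders are
unchanged by the defect. (The naive "decoupling" `Λ_c = Λ` is FALSE already at first order.) -/
def DefectCovariance : Prop :=
  ∀ (Ω : Type) [MeasurableSpace Ω] (μ : Measure Ω) (X : Ω → LoopConfig ℂ),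
    IsProbabilityMeasure μ → IsFullPlaneCNLLaw μ X →
      ∀ f : ℂ → ℝ, Admissible f → ∀ c : ℂ, (∃ r > 0, ∀ z, ‖z - c‖ < r → f z = 0) → ∀ Λ : ℝ,
        HasNestingTransform μ X f Λ →
          Tendsto (truncDefectTransform μ X f c) (𝓝[>] 0)
            (𝓝 (Λ * Real.exp (-(1 / Real.pi) * ∫ x, Real.log ‖x - c‖ * f x)))

/-- **First provable lemma of card identity-charge-decoupling (corrected form):** defect covariance (plus Möbius
invariance of the whole-plane CLE₆ law, an input theorem, and the anomalous covariance of the Euclidean truncation,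
which is LINEAR in `f`) makes every cumulant form of order ≥ 2 Möbius invariant and kills the cubic order. -/
def ThirdOrderOfDefectCovariance : Prop := DefectCovariance → ThirdCumulantVanishes

end Summit.CriticalPhenomena.CardyFormulaZ2.Cruxes.MagicFormulaT.Sketch

end
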